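import Summits.CriticalPhenomena.PercolationContinuityZ3.Theorems.PercNonProliferationFreeBoxPowerSavingArmCauchySchwarz
import Summits.CriticalPhenomena.PercolationContinuityZ3.Theorems.PercNonProliferationFreeBoxPowerSavingUnconditionalArmFromCrux
import Summits.CriticalPhenomena.PercolationContinuityZ3.Theorems.PercNonProliferationFreeBoxPowerSavingCesaroBlockingGivesOneArm
import Summits.CriticalPhenomena.PercolationContinuityZ3.Theorems.FreeBoxPowerSaving.Negative.FreeBoxPowerSavingOneArm
import Summits.CriticalPhenomena.PercolationContinuityZ3.Theorems.PercNonSelfAveragingStrictFKGLadder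
import Summits.CriticalPhenomena.PercolationContinuityZ3.Theorems.PercNonProliferationPolynomialAssembly
import Summits.CriticalPhenomena.PercolationContinuityZ3.Theses.PercAnnulusCrossing
import HarnessLib

/-!
# Crux `PercNonProliferation.FreeBoxPowerSaving` (stmt-CriticalPhenomena-4447) — the ONE-ARM DICTIONARY
# (line `Sketch_r2_ideator4`, card `onearm-currency-arm-cauchy-schwarz`; lead a2)

Helper file landed `--supports stmt-CriticalPhenomena-4447`; it proves the registered sub-goal
`stub_armSpanningPair` and assembles the line's four landed stubs
(`stub_armCauchySchwarz` p125191, `stub_pairGivesOneArm` p125354, `stub_unconditionalArmFromCrux` p125680,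
`stub_cesaroBlockingGivesOneArm` p126229) into name-keyed, hypothesis-free statements over tree vocabulary.

Notation: `π_p(m) = oneArmProb 3 p m`, `FA₂ᵖ(n) = fa2 p n = |B(n)|⁻² Σ_{x,y∈B(n)} P_p(x ↔ y in B(n))`,
`E_p[N_n] = Σ_{k<|B(n)|} P_p(repEvent 3 k n)` (mean number of clusters of the open graph induced on `B(2n)` meeting
`B(n)` and `∂ⁱⁿB(2n)`), `A_p(n) = Σ_{x∈B(n)} P_p(x ↔ ∂ⁱⁿB(2n) in B(2n))` (arm mass),
`u_m(p) = blockProb 3 p m = P_p(B(m) ↮ ∂ⁱⁿB(2m) in B(2m))`, `p_c = criticalProbI 3`, r4 = `SubpolynomialBlocking`,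
r5 = the crux `FreeBoxPowerSaving`, `X_B = PercAnnulusCrossing.CritAnnulusNonCrossing` (stmt-CriticalPhenomena-0846).

* `OneArmDictionary.armFloor` — `|B(n)|·π_p(3n) ≤ A_p(n)` (every `p`, `n`).
* `stub_armSpanningPair` (registered) / `OneArmDictionary.armSpanningPair` — the ASP inequality
  `π_p(3n)² ≤ 64·E_p[N_n]·FA₂ᵖ(2n)` (every `p`, `n ≥ 1`): "(one-arm)² ≤ (mean spanning number) × (free pair
  connectivity)"; no FKG, no uniqueness, no ergodic theorem.
* `OneArmDictionary.oneArm_rate_of_polynomialPair` — r4 → r5 → `∃ s > 0, C, ∀ m ≥ 1, π_{p_c}(m) ≤ C m^{-s}`, and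
  `OneArmDictionary.freeBoxPowerSaving_iff_oneArm_rate` — GIVEN r4, THE CRUX IS POLYNOMIAL ONE-ARM DECAY AT `p_c(ℤ³)`
  (converse = the landed `of_oneArm_decay`, p75695; dictionary `a = 2s` both ways).
* `OneArmDictionary.exists_oneArm_rate_of_powerSaving` — unconditionally (landed PowerCap `E_{p_c}[N_n] ≤ C n^{2-β}`):
  for some `β > 0`, a power saving with exponent `a > 2 - β` gives a one-arm rate `(a-2+β)/2`.
* `OneArmDictionary.freeBoxPowerSaving_of_cesaroBlocking`, `…percolationContinuityZ3_of_cesaroBlocking` — Cesàro blocking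
  `∃ c > 0, ∀ᶠ K, cK ≤ Σ_{j<K} u_{2^j}(p_c)` gives the crux AND `θ(p_c) = 0` (so the line's transfer stub is summit-strength);
  `OneArmDictionary.cesaroBlocking_of_critAnnulusNonCrossing`, `…freeBoxPowerSaving_of_critAnnulusNonCrossing` — new cone edge
  `X_B ⟹ r5` (and `X_B ⟹` one-arm power decay).
* CALIBRATION: `OneArmDictionary.sum_blockProb_two_pow_le` — `Σ_{j<K} u_{2^j}(p_c) ≤ log 42 + K log 2` (the DCT one-arm
  floor `π_{p_c}(m) ≥ 1/(6(4m+3))` against the multi-scale product bound), hence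
  `OneArmDictionary.cesaroBlocking_const_le_log_two` — a Cesàro blocking constant at `p_c(ℤ³)` is `≤ log 2`.
No new definitions; no sorry.
-/

noncomputable section

namespace Summit.CriticalPhenomena.PercolationContinuityZ3.FreeBoxPowerSavingLine

open MeasureTheory Filter
open Literature.Probability.Percolation Literature.Probability.LatticeModels
open Summit.CriticalPhenomena.PercolationContinuityZ3.Theses.PercNonProliferation
open Summit.CriticalPhenomena.PercolationContinuityZ3.FreeBoxPowerSavingNegative
  (pairSum fa2 pairSum_nonneg card_box_pos fa2_nonneg of_oneArm_decay oneArmProb_criticalProbI_ge)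
open Summit.CriticalPhenomena.PercolationContinuityZ3.Theorems.SubpolynomialBlocking.Negative (blockProb blockProb_eq)
open Summit.CriticalPhenomena.PercolationContinuityZ3.Theorems.NonProliferation.Negative (repEvent)
open scoped Topology BigOperators

namespace OneArmDictionary

/-- **Arm floor** `|B(n)| · π_p(3n) ≤ A_p(n)`: for `x ∈ B(n)`, `B(2n) ⊆ x + B(3n)`, so an open path from `x` to
`x + ∂ⁱⁿB(3n)` reaches `∂ⁱⁿB(2n)` by an initial segment inside `B(2n)` (tree: `oneArmProb_three_mul_le_real_toBdry`,
first exit + translation invariance); sum over `x ∈ B(n)`. [folklore] -/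
theorem armFloor (p : unitInterval) (n : ℕ) :
    ((box 3 n).card : ℝ) * oneArmProb 3 p (3 * n) ≤
      ∑ x ∈ box 3 n, (bondPercolation (zdGraph 3) p).real
        {ω | ∃ y ∈ innerBoundary (zdGraph 3) (box 3 (2 * n)),
          ω ∈ openConnIn (↑(box 3 (2 * n)) : Set (Site 3)) x y} := by
  rw [← nsmul_eq_mul, ← Finset.sum_const]
  exact Finset.sum_le_sum fun x hx =>
    Summit.CriticalPhenomena.PercolationContinuityZ3.Theorems.oneArmProb_three_mul_le_real_toBdry p hx

/-- `E_p[S_n] ≤ S_p(2n)`: pairs of `B(n)` joined inside `B(2n)` are among the pairs of `B(2n)` joined inside `B(2n)`.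
[folklore] -/
theorem pairsIn_le_pairSum (p : unitInterval) (n : ℕ) :
    ∑ x ∈ box 3 n, ∑ y ∈ box 3 n,
        (bondPercolation (zdGraph 3) p).real (openConnIn (↑(box 3 (2 * n)) : Set (Site 3)) x y) ≤
      pairSum p (2 * n) := by
  unfold pairSum
  exact Summit.CriticalPhenomena.PercolationContinuityZ3.Theorems.polynomialAssembly_sum_sum_mono
    (box_mono 3 (by omega)) fun x y => measureReal_nonneg

end OneArmDictionary

open OneArmDictionary in
/-- **Registered sub-goal `stub_armSpanningPair` — the arm–spanning–pair inequality (ASP)**: for every `p` and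
`n ≥ 1`, `π_p(3n)² ≤ 64 · E_p[N_n] · FA₂ᵖ(2n)`.  Chain: `(|B(n)| π(3n))² ≤ A_p(n)²` (arm floor)
`≤ E[N_n]·E[S_n]` (arm-mass Cauchy–Schwarz, landed `stub_armCauchySchwarz`) `≤ E[N_n]·S(2n) = E[N_n]·FA₂(2n)·|B(2n)|²
≤ E[N_n]·FA₂(2n)·64|B(n)|²` (`|B(2n)| ≤ 8|B(n)|`), divide by `|B(n)|² > 0`.  Dimension-free; sharp at the exponent level
both in `d = 3` numerics and in mean field (`E N ≍ n^{d-6}`). [folklore] -/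
theorem stub_armSpanningPair :
    ∀ (p : unitInterval) (n : ℕ), 1 ≤ n →
      oneArmProb 3 p (3 * n) ^ 2 ≤
        64 * (∑ k ∈ Finset.range (box 3 n).card, (bondPercolation (zdGraph 3) p).real
          {ω | ∃ x : Fin (k + 1) → Site 3, (∀ i, x i ∈ box 3 n) ∧
            (∀ i, ∃ y ∈ innerBoundary (zdGraph 3) (box 3 (2 * n)),
              ω ∈ openConnIn (↑(box 3 (2 * n)) : Set (Site 3)) (x i) y) ∧
            ∀ i j, i ≠ j → ω ∉ openConnIn (↑(box 3 (2 * n)) : Set (Site 3)) (x i) (x j)}) *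
        ((∑ x ∈ box 3 (2 * n), ∑ y ∈ box 3 (2 * n),
            (bondPercolation (zdGraph 3) p).real (openConnIn (↑(box 3 (2 * n)) : Set (Site 3)) x y)) /
          ((box 3 (2 * n)).card : ℝ) ^ 2) := by
  intro p n _hn
  -- abbreviations
  set EN : ℝ := ∑ k ∈ Finset.range (box 3 n).card, (bondPercolation (zdGraph 3) p).real
    {ω | ∃ x : Fin (k + 1) → Site 3, (∀ i, x i ∈ box 3 n) ∧
      (∀ i, ∃ y ∈ innerBoundary (zdGraph 3) (box 3 (2 * n)),
        ω ∈ openConnIn (↑(box 3 (2 * n)) : Set (Site 3)) (x i) y) ∧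
      ∀ i j, i ≠ j → ω ∉ openConnIn (↑(box 3 (2 * n)) : Set (Site 3)) (x i) (x j)} with hEN
  set A : ℝ := ∑ x ∈ box 3 n, (bondPercolation (zdGraph 3) p).real
    {ω | ∃ y ∈ innerBoundary (zdGraph 3) (box 3 (2 * n)),
      ω ∈ openConnIn (↑(box 3 (2 * n)) : Set (Site 3)) x y} with hA
  set ES : ℝ := ∑ x ∈ box 3 n, ∑ y ∈ box 3 n,
    (bondPercolation (zdGraph 3) p).real (openConnIn (↑(box 3 (2 * n)) : Set (Site 3)) x y) with hES
  have hCS : A ^ 2 ≤ EN * ES := stub_armCauchySchwarz p n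
  have hb := card_box_pos n
  have hb2 := card_box_pos (2 * n)
  have h8 := Summit.CriticalPhenomena.PercolationContinuityZ3.Theorems.FreeBoxSparse.Negative.card_box_two_mul_le n
  have hEN0 : 0 ≤ EN := Finset.sum_nonneg fun _ _ => measureReal_nonneg
  have hfloor : ((box 3 n).card : ℝ) * oneArmProb 3 p (3 * n) ≤ A := armFloor p n
  have hπ0 : 0 ≤ oneArmProb 3 p (3 * n) := measureReal_nonneg
  -- `E[S] ≤ S(2n)` and `S(2n) = FA₂(2n)·|B(2n)|²`
  have hS : ES ≤ pairSum p (2 * n) := pairsIn_le_pairSum p n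
  have hF : pairSum p (2 * n) / ((box 3 (2 * n)).card : ℝ) ^ 2 * ((box 3 (2 * n)).card : ℝ) ^ 2 =
      pairSum p (2 * n) := by
    field_simp
  have hF0 : 0 ≤ pairSum p (2 * n) / ((box 3 (2 * n)).card : ℝ) ^ 2 :=
    div_nonneg (pairSum_nonneg p _) (by positivity)
  have hb2sq : ((box 3 (2 * n)).card : ℝ) ^ 2 ≤ 64 * ((box 3 n).card : ℝ) ^ 2 := by
    calc ((box 3 (2 * n)).card : ℝ) ^ 2 ≤ (8 * ((box 3 n).card : ℝ)) ^ 2 := pow_le_pow_left₀ hb2.le h8 2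
      _ = 64 * ((box 3 n).card : ℝ) ^ 2 := by ring
  have key : ((box 3 n).card : ℝ) ^ 2 * oneArmProb 3 p (3 * n) ^ 2 ≤
      ((box 3 n).card : ℝ) ^ 2 *
        (64 * EN * (pairSum p (2 * n) / ((box 3 (2 * n)).card : ℝ) ^ 2)) := by
    calc ((box 3 n).card : ℝ) ^ 2 * oneArmProb 3 p (3 * n) ^ 2
        = (((box 3 n).card : ℝ) * oneArmProb 3 p (3 * n)) ^ 2 := by ring
      _ ≤ A ^ 2 := pow_le_pow_left₀ (by positivity) hfloor 2
      _ ≤ EN * ES := hCS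
      _ ≤ EN * pairSum p (2 * n) := mul_le_mul_of_nonneg_left hS hEN0
      _ = EN * (pairSum p (2 * n) / ((box 3 (2 * n)).card : ℝ) ^ 2 * ((box 3 (2 * n)).card : ℝ) ^ 2) := by
          rw [hF]
      _ ≤ EN * (pairSum p (2 * n) / ((box 3 (2 * n)).card : ℝ) ^ 2 * (64 * ((box 3 n).card : ℝ) ^ 2)) :=
          mul_le_mul_of_nonneg_left (mul_le_mul_of_nonneg_left hb2sq hF0) hEN0
      _ = ((box 3 n).card : ℝ) ^ 2 *
            (64 * EN * (pairSum p (2 * n) / ((box 3 (2 * n)).card : ℝ) ^ 2)) := by ring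
  have := le_of_mul_le_mul_left key (by positivity)
  simpa only [pairSum] using this

namespace OneArmDictionary

/-- **ASP, name-keyed**: `π_p(3n)² ≤ 64 · E_p[N_n] · FA₂ᵖ(2n)` with `E_p[N_n] = Σ_k P_p(repEvent 3 k n)` and
`FA₂ᵖ = fa2 p` (definitional reading of `stub_armSpanningPair`). [folklore] -/
theorem armSpanningPair (p : unitInterval) {n : ℕ} (hn : 1 ≤ n) :
    oneArmProb 3 p (3 * n) ^ 2 ≤
      64 * (∑ k ∈ Finset.range (box 3 n).card, (bondPercolation (zdGraph 3) p).real (repEvent 3 k n)) *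
        fa2 p (2 * n) :=
  stub_armSpanningPair p n hn

/-- **r4 ∧ r5 ⟹ polynomial one-arm decay at `p_c(ℤ³)`** (ASP + the landed `stub_pairGivesOneArm`: BK cap
`E[N_n] ≤ 1/u_n`, r4 `u_n ≥ n^{-a/2}` eventually, the crux at `2n`; exponent `a/4`). [folklore] -/
theorem oneArm_rate_of_polynomialPair (h4 : SubpolynomialBlocking) (h5 : FreeBoxPowerSaving) :
    ∃ s C : ℝ, 0 < s ∧ ∀ m : ℕ, 1 ≤ m → oneArmProb 3 (criticalProbI 3) m ≤ C * (m : ℝ) ^ (-s) :=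
  stub_pairGivesOneArm stub_armSpanningPair h4 h5

/-- **THE DICTIONARY: given r4 `SubpolynomialBlocking`, the crux `FreeBoxPowerSaving` IS polynomial one-arm decay at
`p_c(ℤ³)`** (`⟹`: `oneArm_rate_of_polynomialPair`; `⟸`: the landed `of_oneArm_decay`, p75695, with `a = 2 min(s,1)`).
So inside its only assembly (the polynomial pair of route PercNonProliferation) the crux is the positivity of the
one-arm exponent of `ℤ³`. [folklore] -/
theorem freeBoxPowerSaving_iff_oneArm_rate (h4 : SubpolynomialBlocking) :
    FreeBoxPowerSaving ↔
      ∃ s C : ℝ, 0 < s ∧ ∀ m : ℕ, 1 ≤ m → oneArmProb 3 (criticalProbI 3) m ≤ C * (m : ℝ) ^ (-s) :=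
  ⟨oneArm_rate_of_polynomialPair h4, fun ⟨_, _, hs, hC⟩ => of_oneArm_decay hs hC⟩

/-- **Unconditional arm rate from a power saving** (ASP + landed PowerCap `E_{p_c}[N_n] ≤ C₀ n^{2-β}`): there is
`β > 0` such that `FA₂(n) ≤ C n^{-a}` (`n ≥ 1`) with `a > 2 - β` gives `π_{p_c}(m) ≤ C' m^{-(a-2+β)/2}` (`m ≥ 1`).
Non-vacuous only for `a ∈ (2-β, 2]` (any power-saving witness has `a ≤ 2`, `FreeBoxSparse.Negative.DCTFloor`). [folklore] -/
theorem exists_oneArm_rate_of_powerSaving :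
    ∃ β : ℝ, 0 < β ∧ ∀ a C : ℝ, 2 - β < a →
      (∀ n : ℕ, 1 ≤ n → fa2 (criticalProbI 3) n ≤ C * (n : ℝ) ^ (-a)) →
      ∃ C' : ℝ, ∀ m : ℕ, 1 ≤ m →
        oneArmProb 3 (criticalProbI 3) m ≤ C' * (m : ℝ) ^ (-((a - 2 + β) / 2)) :=
  stub_unconditionalArmFromCrux fun n hn => stub_armSpanningPair (criticalProbI 3) n hn

/-- A polynomial one-arm rate at `p_c` forces `θ(p_c(ℤ³)) = 0` (`θ ≤ π(m) → 0`). [folklore] -/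
theorem theta_eq_zero_of_oneArm_rate {s C : ℝ} (hs : 0 < s)
    (hC : ∀ m : ℕ, 1 ≤ m → oneArmProb 3 (criticalProbI 3) m ≤ C * (m : ℝ) ^ (-s)) :
    theta (zdGraph 3) (0 : Site 3) (criticalProbI 3) = 0 := by
  have hθ0 : 0 ≤ theta (zdGraph 3) (0 : Site 3) (criticalProbI 3) := measureReal_nonneg
  have hle : ∀ m : ℕ, 1 ≤ m → theta (zdGraph 3) (0 : Site 3) (criticalProbI 3) ≤ C * (m : ℝ) ^ (-s) :=
    fun m hm => (DCT16.theta_le_real_siteToBoundary (criticalProbI 3) m).trans (hC m hm)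
  have hlim : Tendsto (fun m : ℕ => C * (m : ℝ) ^ (-s)) atTop (𝓝 0) := by
    have h := ((tendsto_rpow_neg_atTop hs).comp tendsto_natCast_atTop_atTop).const_mul C
    rw [mul_zero] at h
    exact h
  exact le_antisymm (ge_of_tendsto hlim ((eventually_ge_atTop 1).mono hle)) hθ0

/-- **The polynomial pair re-priced**: r4 → r5 → `PercolationContinuityZ3` THROUGH a one-arm rate (the route's
`PolynomialAssembly`, factored through `oneArm_rate_of_polynomialPair`). [folklore] -/
theorem percolationContinuityZ3_of_polynomialPair (h4 : SubpolynomialBlocking) (h5 : FreeBoxPowerSaving) :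
    _root_.PercolationContinuityZ3 := by
  obtain ⟨s, C, hs, hC⟩ := oneArm_rate_of_polynomialPair h4 h5
  exact Literature.Probability.Percolation.percolationContinuityZ3_iff.2 (theta_eq_zero_of_oneArm_rate hs hC)

/-! ### The engine side: Cesàro blocking -/

/-- **Cesàro blocking at `p_c` gives the crux**: `∃ c > 0, ∀ᶠ K, cK ≤ Σ_{j<K} u_{2^j}(p_c)` ⟹ one-arm power decay
(landed `stub_cesaroBlockingGivesOneArm`, independence of the pure dyadic-annulus crossings) ⟹ `FreeBoxPowerSaving`
(`of_oneArm_decay`). [folklore] -/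
theorem freeBoxPowerSaving_of_cesaroBlocking
    (h : ∃ c : ℝ, 0 < c ∧ ∀ᶠ K : ℕ in atTop, c * (K : ℝ) ≤
      ∑ j ∈ Finset.range K, blockProb 3 (criticalProbI 3) (2 ^ j)) :
    FreeBoxPowerSaving := by
  obtain ⟨s, C, hs, hC⟩ := stub_cesaroBlockingGivesOneArm (criticalProbI 3) h
  exact of_oneArm_decay hs hC

/-- **Cesàro blocking at `p_c` is SUMMIT-strength**: it gives `PercolationContinuityZ3` (`θ(p_c(ℤ³)) = 0`) outright.
[folklore] -/
theorem percolationContinuityZ3_of_cesaroBlocking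
    (h : ∃ c : ℝ, 0 < c ∧ ∀ᶠ K : ℕ in atTop, c * (K : ℝ) ≤
      ∑ j ∈ Finset.range K, blockProb 3 (criticalProbI 3) (2 ^ j)) :
    _root_.PercolationContinuityZ3 := by
  obtain ⟨s, C, hs, hC⟩ := stub_cesaroBlockingGivesOneArm (criticalProbI 3) h
  exact Literature.Probability.Percolation.percolationContinuityZ3_iff.2 (theta_eq_zero_of_oneArm_rate hs hC)

/-- **`X_B ⟹` Cesàro blocking** (trivially, with the same constant: `u_n(p_c) ≥ c` for all `n ≥ 1`, in particular
at every dyadic scale). [folklore] -/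
theorem cesaroBlocking_of_critAnnulusNonCrossing
    (hXB : Summit.CriticalPhenomena.PercolationContinuityZ3.Theses.PercAnnulusCrossing.CritAnnulusNonCrossing) :
    ∃ c : ℝ, 0 < c ∧ ∀ᶠ K : ℕ in atTop, c * (K : ℝ) ≤
      ∑ j ∈ Finset.range K, blockProb 3 (criticalProbI 3) (2 ^ j) := by
  obtain ⟨c, hc, h⟩ := hXB
  refine ⟨c, hc, Eventually.of_forall fun K => ?_⟩
  have hterm : ∀ j ∈ Finset.range K, c ≤ blockProb 3 (criticalProbI 3) (2 ^ j) := by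
    intro j _
    have hj := h (2 ^ j) Nat.one_le_two_pow
    rw [blockProb_eq]
    change (bondPercolation (zdGraph 3) (criticalProbI 3)).real
      (Literature.Barriers.CriticalPhenomena.annulusCrossing 3 (2 ^ j)) ≤ 1 - c at hj
    linarith
  calc c * (K : ℝ) = ∑ _j ∈ Finset.range K, c := by rw [Finset.sum_const, Finset.card_range, nsmul_eq_mul, mul_comm]
    _ ≤ _ := Finset.sum_le_sum hterm

/-- **New cone edge `X_B ⟹ r5`**: `PercAnnulusCrossing.CritAnnulusNonCrossing` (stmt-CriticalPhenomena-0846) implies the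
crux `FreeBoxPowerSaving` (via Cesàro blocking and the one-arm rate; compare Disproof §10: `X_A ⟹ r5`). [folklore] -/
theorem freeBoxPowerSaving_of_critAnnulusNonCrossing
    (hXB : Summit.CriticalPhenomena.PercolationContinuityZ3.Theses.PercAnnulusCrossing.CritAnnulusNonCrossing) :
    FreeBoxPowerSaving :=
  freeBoxPowerSaving_of_cesaroBlocking (cesaroBlocking_of_critAnnulusNonCrossing hXB)

/-- **`X_B ⟹` polynomial one-arm decay at `p_c(ℤ³)`** (the classical dyadic-annulus argument, now kernel-checked).
[folklore] -/
theorem oneArm_rate_of_critAnnulusNonCrossing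
    (hXB : Summit.CriticalPhenomena.PercolationContinuityZ3.Theses.PercAnnulusCrossing.CritAnnulusNonCrossing) :
    ∃ s C : ℝ, 0 < s ∧ ∀ m : ℕ, 1 ≤ m → oneArmProb 3 (criticalProbI 3) m ≤ C * (m : ℝ) ^ (-s) :=
  stub_cesaroBlockingGivesOneArm (criticalProbI 3) (cesaroBlocking_of_critAnnulusNonCrossing hXB)

/-! ### Calibration: how large a Cesàro blocking constant can be at `p_c(ℤ³)` -/

/-- **Upper bound on the Cesàro blocking sum at `p_c(ℤ³)`**: `Σ_{j<K} u_{2^j}(p_c) ≤ log 42 + K log 2` for every `K`.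
The multi-scale product bound `π_{p_c}(2^K) ≤ exp(-Σ_{j<K} u_{2^j})` (`CesaroBlockingGivesOneArm.oneArmProb_two_pow_le_exp`)
meets the Duminil-Copin–Tassion one-arm floor `π_{p_c}(m) ≥ 1/(6(4m+3))` (`oneArmProb_criticalProbI_ge`), and
`6(4·2^K+3) ≤ 42·2^K`. [folklore] -/
theorem sum_blockProb_two_pow_le (K : ℕ) :
    ∑ j ∈ Finset.range K, blockProb 3 (criticalProbI 3) (2 ^ j) ≤ Real.log 42 + K * Real.log 2 := by
  set S : ℝ := ∑ j ∈ Finset.range K, blockProb 3 (criticalProbI 3) (2 ^ j) with hS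
  have hexp : 1 / (6 * (4 * (((2 ^ K : ℕ) : ℝ)) + 3)) ≤ Real.exp (-S) :=
    (oneArmProb_criticalProbI_ge (2 ^ K)).trans (CesaroBlockingGivesOneArm.oneArmProb_two_pow_le_exp (d := 3) _ K)
  have hD : (0 : ℝ) < 6 * (4 * (((2 ^ K : ℕ) : ℝ)) + 3) := by positivity
  have hlog : Real.log (1 / (6 * (4 * (((2 ^ K : ℕ) : ℝ)) + 3))) ≤ -S :=
    (Real.log_le_iff_le_exp (by positivity)).2 hexp
  rw [one_div, Real.log_inv] at hlog
  have h2K : (0 : ℝ) < (2 : ℝ) ^ K := by positivity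
  have hle : 6 * (4 * (((2 ^ K : ℕ) : ℝ)) + 3) ≤ 42 * (2 : ℝ) ^ K := by
    push_cast
    have : (1 : ℝ) ≤ (2 : ℝ) ^ K := one_le_pow₀ (by norm_num)
    nlinarith
  have hlog2 : Real.log (6 * (4 * (((2 ^ K : ℕ) : ℝ)) + 3)) ≤ Real.log 42 + K * Real.log 2 := by
    calc Real.log (6 * (4 * (((2 ^ K : ℕ) : ℝ)) + 3)) ≤ Real.log (42 * (2 : ℝ) ^ K) := Real.log_le_log hD hle
      _ = Real.log 42 + K * Real.log 2 := by
          rw [Real.log_mul (by norm_num) h2K.ne', Real.log_pow]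
  linarith

/-- **A Cesàro blocking constant at `p_c(ℤ³)` is at most `log 2`**: if eventually `cK ≤ Σ_{j<K} u_{2^j}(p_c)` then
`c ≤ log 2` (from `sum_blockProb_two_pow_le`). So the transfer stub can only hold with `c ∈ (0, log 2]`. [folklore] -/
theorem cesaroBlocking_const_le_log_two {c : ℝ}
    (h : ∀ᶠ K : ℕ in atTop, c * (K : ℝ) ≤ ∑ j ∈ Finset.range K, blockProb 3 (criticalProbI 3) (2 ^ j)) :
    c ≤ Real.log 2 := by
  by_contra hc
  push Not at hc
  have hpos : 0 < c - Real.log 2 := sub_pos.2 hc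
  obtain ⟨K, hK, hKbig⟩ := (h.and (eventually_gt_atTop ⌈Real.log 42 / (c - Real.log 2)⌉₊)).exists
  have h1 : c * (K : ℝ) ≤ Real.log 42 + K * Real.log 2 := hK.trans (sum_blockProb_two_pow_le K)
  have hK' : Real.log 42 / (c - Real.log 2) < K :=
    (Nat.le_ceil _).trans_lt (by exact_mod_cast hKbig)
  rw [div_lt_iff₀ hpos] at hK'
  have h2 : (K : ℝ) * (c - Real.log 2) = c * K - K * Real.log 2 := by ring
  linarith

end OneArmDictionary

end Summit.CriticalPhenomena.PercolationContinuityZ3.FreeBoxPowerSavingLine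

end
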